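import Summits.MatrixMultiplication.MatrixMultiplication.Theses.ShapeSubmodularity
import Summits.MatrixMultiplication.MatrixMultiplication.Theses.EPRFaces
import Literature.Computability.AlgebraicComplexity.RectangularExponentLaserCertificate
import Literature.Computability.AlgebraicComplexity.RectangularExponentAsymptoticRank
import Literature.Computability.AlgebraicComplexity.LaserMethodTypeCount
import Literature.Computability.AlgebraicComplexity.LaserMethodBigCW
import Literature.Computability.AlgebraicComplexity.SchonhageRectangular

/-!
# Skeleton (lead, reshaped) for crux `PerfectAmortisation` (E) — stmt-MatrixMultiplication-10893,
line `registered` (= `Lines/birth.lean`)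

Route `route-MatrixMultiplication-ShapeSubmodularity` (crux shared verbatim with route EPRFaces).
The crux, in rank form: `E : ∀ ε > 0, ∃ k ≥ 1, R(⟨n, n, n^k⟩) = O(n^{k+1+ε})`.

LINE (Coppersmith 1982 / Lotti–Romani 1983 Prop. 4.1 in modern dress): the FIRST-POWER laser method
on `CW_q` with the far-rectangular joint type `Q = (m on (1,1,0), m on (0,1,1), k·m on (1,0,1))`,
`N = (k+2)·m`; Schönhage's rectangular asymptotic sum inequality; then `q = 2k+4`, `k → ∞`.

RESHAPE (lead, cycle 1): the planner's size-L stub `stub_cwLaserPacking` is split into four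
registered stubs over the tree's general laser-method layers, composed SORRY-FREE below into the
planner's exact signature (`cwLaserPacking_of_stubs`):
* `stub_cwRectRestriction` — tensor layer: a free diagonal `Δ` of level triples of joint type
  `(m₁, m₂, m₃)` on the three matrix patterns gives the RESTRICTION
  `CW_q^{⊗N} ≥ ⟨|Δ|⟩ ⊗ ⟨q^{m₁}, q^{m₂}, q^{m₃}⟩`
  (`tensorRestrictsTo_kroneckerPow_matMulDirectSum_of_free` with the `CW_q` data of
  `LaserMethodBigCW`, then the relabelling `matMulDirectSum (const) ≅ ⟨p⟩ ⊗ ⟨k,m,n⟩`);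
* `stub_cwRectDiagonalRaw` — combinatorial layer: `exists_free_diagonal_jointType_card` for
  `S = cwSupport₃`, `Q` as above, with the numerical constants of `Fin 3 × Fin 3 × Fin 3` evaluated
  (`G = 27`, `A = 9`, `b = 2`): a free `Δ ⊆ Φ_Q` with
  `2^{N (min_m H(P_m) − Γ_S(P))} ≤ |Δ| (N+1)^63 · 192 · exp(4 √(log 6 + N log 27))`;
* `stub_cwRectEntropy` — the entropy evaluation for `P = Q/N`:
  `log 2 · (min_m H(P_m) − Γ_S(P)) ≥ h(1/(k+2))` (marginals `(θ,1−θ,0)`, `(kθ,2θ,0)`, `(θ,1−θ,0)`;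
  `h(2θ) ≥ h(θ)` for `θ ≤ 1/3`; `Γ_S(P) = 0` since the marginals kill level 2 and then force `P`);
* `stub_cwRectThreshold` — the analytic threshold: for `m` large the `o(N)` loss is `≤ δ m log q`,
  turning `exp(N h(θ)) ≲ |Δ|` into `(q+2)^N ≤ |Δ| · (q^m)^{f(k,q)+δ}`;
* `stub_rateVanishes` — unchanged (planner): `∀ ε ∃ q k, f(k,q) < k+1+ε`.
ASSEMBLY (sorry-free, planner): `omegaRect_le_of_packing`, `isBigO_of_omegaRect_lt`,
`PerfectAmortisation_of`, `PerfectAmortisation_proof` (EPRFaces decl) and `_shapeSubmodularity`.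

DISPROOF USED: none — no `Disproof.lean` registered for this crux (`ledger crux ls`, 2026-08-17T06Z).
-/

set_option linter.dupNamespace false
-- (single-conjunct summit: the namespace repeats `MatrixMultiplication`)

namespace Summit.MatrixMultiplication.MatrixMultiplication.Cruxes.PerfectAmortisation.Birth

open Literature.Computability.AlgebraicComplexity
open Literature.Barriers.MatrixMultiplication
open Filter Asymptotics

/-! ## Stubs -/

/-- **Stub A (tensor layer: the blocks of one joint type along a free diagonal are a multiple of
one rectangular matrix tensor).**  For level triples `Δ` of `CW_q^{⊗N}` supported coordinatewise in
`{i+j+l = 2}`, all with `m₁` positions of pattern `(1,1,0)`, `m₂` of `(0,1,1)`, `m₃` of `(1,0,1)`,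
forming a free diagonal, `CW_q^{⊗N}` restricts to `⟨|Δ|⟩ ⊗ ⟨q^{m₁}, q^{m₂}, q^{m₃}⟩`
(BCS 1997 Prop. 15.30 / proof of Thm. 15.41 p. 381, via
`tensorRestrictsTo_kroneckerPow_matMulDirectSum_of_free` and the `CW_q` component data
`cwFmtK/M/N`, `cwEI/EJ/EL`, `bigCwTensor_component`). -/
theorem stub_cwRectRestriction :
    ∀ (q m₁ m₂ m₃ N : ℕ)
      (Δ : Finset ((Fin N → Fin 3) × (Fin N → Fin 3) × (Fin N → Fin 3))),
      (∀ δ ∈ Δ, ∀ ρ, labelSeq δ ρ ∈ cwSupport₃) →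
      (∀ δ ∈ Δ, letterCount (labelSeq δ) (1, 1, 0) = m₁ ∧ letterCount (labelSeq δ) (0, 1, 1) = m₂ ∧
        letterCount (labelSeq δ) (1, 0, 1) = m₃) →
      (∀ δ ∈ Δ, ∀ δ' ∈ Δ, ∀ δ'' ∈ Δ, (∀ ρ, (δ.1 ρ, δ'.2.1 ρ, δ''.2.2 ρ) ∈ cwSupport₃) →
        δ = δ' ∧ δ' = δ'') →
      TensorRestrictsTo (kroneckerPow (bigCwTensor ℂ q) N)
        (kroneckerTensor (unitTensor ℂ Δ.card) (matMulTensor ℂ (q ^ m₁) (q ^ m₂) (q ^ m₃))) := by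
  sorry

/-- **Stub B1 (combinatorial layer: a large free diagonal inside the far-rectangular joint type).**
`exists_free_diagonal_jointType_card` for `S = cwSupport₃` (2-tight via `i ↦ i`, `j ↦ j`,
`l ↦ l − 2`), `N = (k+2)m`, `Q = (m, m, k m)` on `(1,1,0), (0,1,1), (1,0,1)`, `P = Q/N`, with the
constants of `Fin 3 × Fin 3 × Fin 3` evaluated (`|I×J×L| = 27`, `|I|+|J|+|L| = 9`, `max b 1 = 2`).
(Le Gall 2014 Lemma A.2 / BCS Thm. 15.39 with a Bertrand prime and the Salem–Spencer diagonal,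
Behrend's bound.) -/
theorem stub_cwRectDiagonalRaw :
    ∀ m k : ℕ, 1 ≤ m → 1 ≤ k → ∀ P : Fin 3 × Fin 3 × Fin 3 → ℝ,
      (∀ s, P s = ((if s = (1, 1, 0) then m else if s = (0, 1, 1) then m
          else if s = (1, 0, 1) then k * m else 0 : ℕ) : ℝ) / (((k + 2) * m : ℕ) : ℝ)) →
      ∃ Δ : Finset ((Fin ((k + 2) * m) → Fin 3) × (Fin ((k + 2) * m) → Fin 3) ×
          (Fin ((k + 2) * m) → Fin 3)),
        (∀ δ ∈ Δ, ∀ ρ, labelSeq δ ρ ∈ cwSupport₃) ∧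
        (∀ δ ∈ Δ, letterCount (labelSeq δ) (1, 1, 0) = m ∧ letterCount (labelSeq δ) (0, 1, 1) = m ∧
          letterCount (labelSeq δ) (1, 0, 1) = k * m) ∧
        (∀ δ ∈ Δ, ∀ δ' ∈ Δ, ∀ δ'' ∈ Δ, (∀ ρ, (δ.1 ρ, δ'.2.1 ρ, δ''.2.2 ρ) ∈ cwSupport₃) →
          δ = δ' ∧ δ' = δ'') ∧
        (2 : ℝ) ^ ((((k + 2) * m : ℕ) : ℝ) *
            (min (shannonEntropy (marginalDist₁ P))
              (min (shannonEntropy (marginalDist₂ P)) (shannonEntropy (marginalDist₃ P))) -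
              maxEntropyPenalty cwSupport₃ P)) ≤
          (Δ.card : ℝ) * ((((k + 2) * m : ℕ) : ℝ) + 1) ^ 63 * 192 *
            Real.exp (4 * Real.sqrt (Real.log 6 + (((k + 2) * m : ℕ) : ℝ) * Real.log 27)) := by
  sorry

/-- **Stub B2 (entropy evaluation of the far-rectangular joint type).**  For `P = Q/N` as in stub
B1 (`P(1,1,0) = P(0,1,1) = θ`, `P(1,0,1) = kθ`, `θ = 1/(k+2)`): the marginals are `(θ, 1−θ, 0)`,
`(kθ, 2θ, 0)`, `(θ, 1−θ, 0)` with Shannon entropies (bits) `h(θ)/log 2`, `h(2θ)/log 2`,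
`h(θ)/log 2`; `h(2θ) ≥ h(θ)` for `0 ≤ θ ≤ 1/3`; and the penalty `Γ_S(P) = max_{P'∈D} H(P') − H(P)`
vanishes because a distribution on `{i+j+l=2}` whose marginals kill level `2` is supported on the
three matrix patterns and is then determined by its marginals (`P' = P`).  Hence
`log 2 · (min_m H(P_m) − Γ_S(P)) ≥ h(1/(k+2))` (`Real.binEntropy`, nats). [folklore] -/
theorem stub_cwRectEntropy :
    ∀ m k : ℕ, 1 ≤ m → 1 ≤ k → ∀ P : Fin 3 × Fin 3 × Fin 3 → ℝ,
      (∀ s, P s = ((if s = (1, 1, 0) then m else if s = (0, 1, 1) then m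
          else if s = (1, 0, 1) then k * m else 0 : ℕ) : ℝ) / (((k + 2) * m : ℕ) : ℝ)) →
      Real.binEntropy (1 / ((k : ℝ) + 2)) ≤
        Real.log 2 * (min (shannonEntropy (marginalDist₁ P))
          (min (shannonEntropy (marginalDist₂ P)) (shannonEntropy (marginalDist₃ P))) -
          maxEntropyPenalty cwSupport₃ P) := by
  sorry

/-- **Stub C (analytic threshold).**  For `q ≥ 2`, `k ≥ 1`, `δ > 0` there is `m ≥ 1` such that,
with `N = (k+2)m`, every natural `V` with `exp(N h(1/(k+2))) ≤ V (N+1)^63 192 exp(4√(log 6 + N log 27))`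
satisfies `(q+2)^N ≤ V · (q^m)^{f(k,q)+δ}`, `f(k,q) = (k+2)(log(q+2) − h(1/(k+2)))/log q`: taking
logarithms, `f m log q = N log(q+2) − N h`, so it suffices that the loss
`63 log(N+1) + log 192 + 4 √(log 6 + N log 27) ≤ δ m log q`, true for `m` large (`log x ≤ 2√x`,
`exists_nat_forall_sqrt_le`). [folklore] -/
theorem stub_cwRectThreshold :
    ∀ q k : ℕ, 2 ≤ q → 1 ≤ k → ∀ δ : ℝ, 0 < δ → ∃ m : ℕ, 1 ≤ m ∧ ∀ V : ℕ,
      Real.exp ((((k + 2) * m : ℕ) : ℝ) * Real.binEntropy (1 / ((k : ℝ) + 2))) ≤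
          (V : ℝ) * ((((k + 2) * m : ℕ) : ℝ) + 1) ^ 63 * 192 *
            Real.exp (4 * Real.sqrt (Real.log 6 + (((k + 2) * m : ℕ) : ℝ) * Real.log 27)) →
      ((q : ℝ) + 2) ^ ((k + 2) * m) ≤ (V : ℝ) * ((q ^ m : ℕ) : ℝ) ^
          (((k : ℝ) + 2) * (Real.log ((q : ℝ) + 2) - Real.binEntropy (1 / ((k : ℝ) + 2))) /
              Real.log (q : ℝ) + δ) := by
  sorry

/-- **Stub D (the rate: the first-power value has vanishing excess).**  For every `ε > 0` some
`q ≥ 2`, `k ≥ 1` satisfy `f(k,q) < k + 1 + ε`; e.g. `q = 2k+4`, where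
`f(k,2k+4) − (k+1) = (log 2 + (k+2) log((k+3)/(k+2)) − (k+1) log((k+2)/(k+1))) / log(2k+4) < 0.9 / log(2k+4)`. -/
theorem stub_rateVanishes :
    ∀ ε : ℝ, 0 < ε → ∃ q k : ℕ, 2 ≤ q ∧ 1 ≤ k ∧
      ((k : ℝ) + 2) * (Real.log ((q : ℝ) + 2) - Real.binEntropy (1 / ((k : ℝ) + 2))) /
          Real.log (q : ℝ) < (k : ℝ) + 1 + ε := by
  sorry

/-! ## Composition of the packing certificate (sorry-free over stubs A, B1, B2, C) -/

/-- Stubs B1 + B2: the free diagonal of the far-rectangular joint type with the size bound in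
closed form, `exp(N h(1/(k+2))) ≤ |Δ| (N+1)^63 · 192 · exp(4 √(log 6 + N log 27))`. -/
theorem cwRectDiagonal_of_stubs (m k : ℕ) (hm : 1 ≤ m) (hk : 1 ≤ k) :
    ∃ Δ : Finset ((Fin ((k + 2) * m) → Fin 3) × (Fin ((k + 2) * m) → Fin 3) ×
        (Fin ((k + 2) * m) → Fin 3)),
      (∀ δ ∈ Δ, ∀ ρ, labelSeq δ ρ ∈ cwSupport₃) ∧
      (∀ δ ∈ Δ, letterCount (labelSeq δ) (1, 1, 0) = m ∧ letterCount (labelSeq δ) (0, 1, 1) = m ∧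
        letterCount (labelSeq δ) (1, 0, 1) = k * m) ∧
      (∀ δ ∈ Δ, ∀ δ' ∈ Δ, ∀ δ'' ∈ Δ, (∀ ρ, (δ.1 ρ, δ'.2.1 ρ, δ''.2.2 ρ) ∈ cwSupport₃) →
        δ = δ' ∧ δ' = δ'') ∧
      Real.exp ((((k + 2) * m : ℕ) : ℝ) * Real.binEntropy (1 / ((k : ℝ) + 2))) ≤
        (Δ.card : ℝ) * ((((k + 2) * m : ℕ) : ℝ) + 1) ^ 63 * 192 *
          Real.exp (4 * Real.sqrt (Real.log 6 + (((k + 2) * m : ℕ) : ℝ) * Real.log 27)) := by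
  set P : Fin 3 × Fin 3 × Fin 3 → ℝ := fun s =>
    ((if s = (1, 1, 0) then m else if s = (0, 1, 1) then m
        else if s = (1, 0, 1) then k * m else 0 : ℕ) : ℝ) / (((k + 2) * m : ℕ) : ℝ) with hP
  have hPs : ∀ s, P s = ((if s = (1, 1, 0) then m else if s = (0, 1, 1) then m
      else if s = (1, 0, 1) then k * m else 0 : ℕ) : ℝ) / (((k + 2) * m : ℕ) : ℝ) := fun s => rfl
  obtain ⟨Δ, hS, hcnt, hfree, hsize⟩ := stub_cwRectDiagonalRaw m k hm hk P hPs
  have hent := stub_cwRectEntropy m k hm hk P hPs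
  refine ⟨Δ, hS, hcnt, hfree, le_trans ?_ hsize⟩
  set X : ℝ := min (shannonEntropy (marginalDist₁ P))
      (min (shannonEntropy (marginalDist₂ P)) (shannonEntropy (marginalDist₃ P))) -
      maxEntropyPenalty cwSupport₃ P with hX
  have hN0 : (0 : ℝ) ≤ (((k + 2) * m : ℕ) : ℝ) := Nat.cast_nonneg _
  rw [Real.rpow_def_of_pos two_pos, Real.exp_le_exp]
  calc (((k + 2) * m : ℕ) : ℝ) * Real.binEntropy (1 / ((k : ℝ) + 2))
      ≤ (((k + 2) * m : ℕ) : ℝ) * (Real.log 2 * X) := mul_le_mul_of_nonneg_left hent hN0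
    _ = Real.log 2 * ((((k + 2) * m : ℕ) : ℝ) * X) := by ring

/-- **The planner's `stub_cwLaserPacking`, now derived** (sorry-free over stubs A, B1, B2, C): for
`q ≥ 2`, `k ≥ 1`, `δ > 0` there are `N, V ≥ 1`, `a ≥ 2`, `B ≥ a^k` with
`CW_q^{⊗N} ⊵ ⟨V⟩ ⊗ ⟨a, a, B⟩` and `(q+2)^N ≤ V · a^{f(k,q)+δ}` — witness `m` from stub C,
`N = (k+2)m`, `Δ` from stubs B, `V = |Δ|`, `a = q^m`, `B = q^{km} = a^k`, the degeneration being
the restriction of stub A. -/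
theorem cwLaserPacking_of_stubs :
    ∀ q k : ℕ, 2 ≤ q → 1 ≤ k → ∀ δ : ℝ, 0 < δ →
      ∃ N V a B : ℕ, 1 ≤ N ∧ 1 ≤ V ∧ 2 ≤ a ∧ a ^ k ≤ B ∧
        PolyDegeneratesTo (kroneckerPow (bigCwTensor ℂ q) N)
          (kroneckerTensor (unitTensor ℂ V) (matMulTensor ℂ a a B)) ∧
        ((q : ℝ) + 2) ^ N ≤ (V : ℝ) * (a : ℝ) ^
          (((k : ℝ) + 2) * (Real.log ((q : ℝ) + 2) - Real.binEntropy (1 / ((k : ℝ) + 2))) /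
              Real.log (q : ℝ) + δ) := by
  intro q k hq hk δ hδ
  obtain ⟨m, hm, hC⟩ := stub_cwRectThreshold q k hq hk δ hδ
  obtain ⟨Δ, hS, hcnt, hfree, hsize⟩ := cwRectDiagonal_of_stubs m k hm hk
  have hres := stub_cwRectRestriction q m m (k * m) ((k + 2) * m) Δ hS hcnt hfree
  refine ⟨(k + 2) * m, Δ.card, q ^ m, q ^ (k * m), ?_, ?_, ?_, ?_, hres.polyDegeneratesTo,
    hC Δ.card hsize⟩
  · exact Nat.mul_pos (by omega) (by omega)
  · -- `|Δ| ≥ 1`: the left-hand side of the size bound is positive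
    by_contra h0
    have h0' : Δ.card = 0 := by omega
    rw [h0', Nat.cast_zero, zero_mul, zero_mul, zero_mul] at hsize
    exact absurd hsize (not_le.2 (Real.exp_pos _))
  · exact le_trans hq (Nat.le_self_pow (by omega) q)
  · rw [← pow_mul, mul_comm]

/-! ## Assembly (sorry-free, planner) -/

/-- From the packing certificate at `(q, k)`: `ω(1,1,k) ≤ f(k,q)` — layers 1–2 of every laser-method
paper (`V a^{ω(1,1,k)} ≤ R̃(⟨V⟩ ⊗ ⟨a,a,B⟩) ≤ R̃(CW_q^{⊗N}) ≤ R̃(CW_q)^N ≤ (q+2)^N ≤ V a^{f+δ}`). -/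
theorem omegaRect_le_of_packing
    (hP : ∀ q k : ℕ, 2 ≤ q → 1 ≤ k → ∀ δ : ℝ, 0 < δ →
      ∃ N V a B : ℕ, 1 ≤ N ∧ 1 ≤ V ∧ 2 ≤ a ∧ a ^ k ≤ B ∧
        PolyDegeneratesTo (kroneckerPow (bigCwTensor ℂ q) N)
          (kroneckerTensor (unitTensor ℂ V) (matMulTensor ℂ a a B)) ∧
        ((q : ℝ) + 2) ^ N ≤ (V : ℝ) * (a : ℝ) ^
          (((k : ℝ) + 2) * (Real.log ((q : ℝ) + 2) - Real.binEntropy (1 / ((k : ℝ) + 2))) /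
              Real.log (q : ℝ) + δ))
    {q k : ℕ} (hq : 2 ≤ q) (hk : 1 ≤ k) :
    omegaRect ℂ 1 1 (k : ℝ) ≤
      ((k : ℝ) + 2) * (Real.log ((q : ℝ) + 2) - Real.binEntropy (1 / ((k : ℝ) + 2))) /
        Real.log (q : ℝ) := by
  set f : ℝ := ((k : ℝ) + 2) * (Real.log ((q : ℝ) + 2) - Real.binEntropy (1 / ((k : ℝ) + 2))) /
        Real.log (q : ℝ) with hf
  refine le_of_forall_pos_lt_add fun δ hδ => ?_
  obtain ⟨N, V, a, B, hN, hV, ha, haB, hdeg, hnum⟩ := hP q k hq hk (δ / 2) (half_pos hδ)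
  have ha1 : (1 : ℝ) < a := by exact_mod_cast (by omega : 1 < a)
  have hV0 : (0 : ℝ) < V := by exact_mod_cast (by omega : 0 < V)
  have hk0 : (0 : ℝ) ≤ (k : ℝ) := Nat.cast_nonneg k
  have haB' : (a : ℝ) ^ (k : ℝ) ≤ (B : ℝ) := by
    rw [Real.rpow_natCast]
    exact_mod_cast haB
  have h1 := mul_rpow_omegaRect_le_asymptoticRank ℂ hk0 hV ha haB'
  have h2 := asymptoticRank_le_of_polyDegeneratesTo hdeg
  have hcw : asymptoticRank (bigCwTensor ℂ q) ≤ (q : ℝ) + 2 := by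
    exact_mod_cast asymptoticRank_bigCwTensor_le ℂ q
  have h3 : asymptoticRank (kroneckerPow (bigCwTensor ℂ q) N) ≤ ((q : ℝ) + 2) ^ N :=
    (asymptoticRank_kroneckerPow_le _ hN).trans
      (pow_le_pow_left₀ (asymptoticRank_nonneg _) hcw N)
  have hchain : (V : ℝ) * (a : ℝ) ^ omegaRect ℂ 1 1 (k : ℝ) ≤ (V : ℝ) * (a : ℝ) ^ (f + δ / 2) :=
    h1.trans (h2.trans (h3.trans hnum))
  have h4 : (a : ℝ) ^ omegaRect ℂ 1 1 (k : ℝ) ≤ (a : ℝ) ^ (f + δ / 2) :=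
    le_of_mul_le_mul_left hchain hV0
  have h5 : omegaRect ℂ 1 1 (k : ℝ) ≤ f + δ / 2 := (Real.rpow_le_rpow_left_iff ha1).1 h4
  linarith

/-- Dictionary: a strict upper bound `ω(1,1,k) < β` at a natural exponent `k` is the rank-form
O-bound `R(⟨n, n, n^k⟩) = O(n^β)` (`⌈n^1⌉ = n`, `⌈n^k⌉ = n^k`, upward closure of admissible sets). -/
theorem isBigO_of_omegaRect_lt {k : ℕ} {β : ℝ} (h : omegaRect ℂ 1 1 (k : ℝ) < β) :
    (fun n : ℕ => (tensorRank (matMulTensor ℂ n n (n ^ k)) : ℝ)) =O[atTop]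
      fun n : ℕ => (n : ℝ) ^ β := by
  have hne := rectAdmissibleExponents_nonempty ℂ 1 1 (k : ℝ)
  unfold omegaRect at h
  obtain ⟨β', hβ', hlt⟩ := exists_lt_of_csInf_lt hne h
  have hβ : β ∈ rectAdmissibleExponents ℂ 1 1 (k : ℝ) :=
    mem_rectAdmissibleExponents_of_le hβ' hlt.le
  have hfun : (fun n : ℕ => (tensorRank (matMulTensor ℂ n n (n ^ k)) : ℝ)) =
      fun n : ℕ =>
        (tensorRank (matMulTensor ℂ (rectDim n 1) (rectDim n 1) (rectDim n (k : ℝ))) : ℝ) := by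
    funext n
    rw [tensorRank_matMulTensor_congr ℂ (rectDim_one n).symm (rectDim_one n).symm
      (rectDim_natCast n k).symm]
  rw [hfun]
  exact hβ

/-- **Assembly**: packing certificate and rate imply the crux `PerfectAmortisation` BY NAME (route
ShapeSubmodularity; the EPRFaces / LongBlockAmortisation decls are the same term). -/
theorem PerfectAmortisation_of :
    (∀ q k : ℕ, 2 ≤ q → 1 ≤ k → ∀ δ : ℝ, 0 < δ →
      ∃ N V a B : ℕ, 1 ≤ N ∧ 1 ≤ V ∧ 2 ≤ a ∧ a ^ k ≤ B ∧
        PolyDegeneratesTo (kroneckerPow (bigCwTensor ℂ q) N)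
          (kroneckerTensor (unitTensor ℂ V) (matMulTensor ℂ a a B)) ∧
        ((q : ℝ) + 2) ^ N ≤ (V : ℝ) * (a : ℝ) ^
          (((k : ℝ) + 2) * (Real.log ((q : ℝ) + 2) - Real.binEntropy (1 / ((k : ℝ) + 2))) /
              Real.log (q : ℝ) + δ)) →
    (∀ ε : ℝ, 0 < ε → ∃ q k : ℕ, 2 ≤ q ∧ 1 ≤ k ∧
      ((k : ℝ) + 2) * (Real.log ((q : ℝ) + 2) - Real.binEntropy (1 / ((k : ℝ) + 2))) /
          Real.log (q : ℝ) < (k : ℝ) + 1 + ε) →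
    Summit.MatrixMultiplication.MatrixMultiplication.Theses.ShapeSubmodularity.PerfectAmortisation := by
  intro hP hR ε hε
  obtain ⟨q, k, hq, hk, hlt⟩ := hR ε hε
  refine ⟨k, hk, ?_⟩
  have hω : omegaRect ℂ 1 1 (k : ℝ) < (k : ℝ) + 1 + ε :=
    (omegaRect_le_of_packing hP hq hk).trans_lt hlt
  exact isBigO_of_omegaRect_lt hω

/-- **Registered skeleton conclusion** (h21 skeleton format `<Crux>_proof`): the crux BY NAME — the
item's primary decl `EPRFaces.PerfectAmortisation` (route EPRFaces, rank 2) — from the stubs.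
The only `sorry`s of the file sit inside the five `stub_*` theorems. -/
theorem PerfectAmortisation_proof :
    Summit.MatrixMultiplication.MatrixMultiplication.Theses.EPRFaces.PerfectAmortisation :=
  PerfectAmortisation_of cwLaserPacking_of_stubs stub_rateVanishes

/-- The same conclusion under the sharing route's name `ShapeSubmodularity.PerfectAmortisation`
(route-MatrixMultiplication-ShapeSubmodularity, rank 3; the two decls are the same term). -/
theorem PerfectAmortisation_proof_shapeSubmodularity :
    Summit.MatrixMultiplication.MatrixMultiplication.Theses.ShapeSubmodularity.PerfectAmortisation :=
  PerfectAmortisation_of cwLaserPacking_of_stubs stub_rateVanishes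

end Summit.MatrixMultiplication.MatrixMultiplication.Cruxes.PerfectAmortisation.Birth
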